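import Summits.ABC.ABC.Theorems.TowerFourSubLiouville.Negative.PolySzpiroFloor

/-!
# `TowerFourSubLiouville` (stmt-ABC-1649): the S⁺4 dial at its boundary — `PolySzpiro 6` is FALSE (Szpiro's `ε` is necessary)

Negative-side module of the standing disprover (cycle 12, refuter-cdisprove-stmt-ABC-1649-g12-0, 2026-08-17), completing
`Negative.PolySzpiroFloor` (p140986: `PolySzpiro s` false for `s < 6`, `ABC`-true for `s > 6`).

There the boundary point `s = 6` — Szpiro's conjecture `|Δ| ≪ N⁶⁺ᵋ` WITHOUT its `ε`, in the abc-coordinates of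
`Ideator4.PolySzpiro` (`(abc)² ≤ C·rad(abc)⁶`) — was left "open in the tree, refuted in print (Masser 1990, Zbl 0742.14027)".
This file refutes it in the tree, by an argument that needs no prime counting:

**2-adic accumulation on a cubic twist.**  On `x³ + y³ = 19 z³` start from `(3, 5, 2)` and iterate the tangent (duplication) map
  `(x, y, z) ↦ (x(x³ + 2y³), −y(2x³ + y³), z(x³ − y³))`
(`cubic_dup_identity`: `x³(x³+2y³)³ − y³(2x³+y³)³ = (x³+y³)(x³−y³)³`).  Along the orbit (`cubicFamily`): `gcd(x, y) = 1`, `x, y` odd,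
`x ≢ y (mod 3)` (these three make the raw iterate PRIMITIVE again — the only possible common factor `3` of `x³+2y³`, `2x³+y³` is excluded),
`z ≠ 0`, and **`2^{j+1} ∣ z` after `j` steps** (`x³ − y³` is even).  Each orbit point gives an abc triple `{|x|³, |y|³, 19|z|³}` (in the
order dictated by the signs) with
  `(abc)² = 19² (xyz)⁶`   but   `rad(abc) ≤ |x|·|y|·19·rad(z) ≤ 19·|x|·|y|·|z| / 2^j`,
so `(abc)² ≤ C rad⁶` forces `2^{6j} ≤ 19⁴ C`: impossible for large `j` (`not_polySzpiro_six`).  The heights grow doubly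
exponentially and are irrelevant — the signature `(3,3,3)` is Euclidean, so real sizes cancel exactly in `(abc)²/rad⁶` and only the
`2`-adic saving survives; this is why conics/Pell (where sizes enter as `(xyz)^{−2}`) cannot do it and a genus-one divisibility
sequence can.

Consequences (`not_polySzpiro_of_le_six`, `polySzpiro_iff_of_abc`): the S⁺4 dial is now EXACT — `PolySzpiro s` is false for every
`s ≤ 6` unconditionally and, under `ABC`, true for every `s > 6`; the typed edge `SzpiroEdge` (needs `s < 8`) has content precisely on
`(6, 8)`.  Calibration of a typed strengthening of the crux, not a kill.
-/

-- `Summit.ABC.ABC` is the mandated summit-side namespace (CONVENTIONS §2); the duplicate is deliberate.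
set_option linter.dupNamespace false

namespace Summit.ABC.ABC.Theorems.TowerFourSubLiouville.Negative

open Literature.NumberTheory.DiophantineGeometry (IsABCTriple rad rad_def)
open UniqueFactorizationMonoid (radical radical_mul_dvd radical_pow_dvd radical_dvd_self)

/-! ## The duplication map on `x³ + y³ = k z³` -/

/-- The tangent identity: `x³(x³+2y³)³ + (−y(2x³+y³))³ = (x³+y³)(x³−y³)³`, so the duplication map preserves `x³ + y³ = 19z³`. -/
theorem cubic_dup_identity {x y z : ℤ} (h : x ^ 3 + y ^ 3 = 19 * z ^ 3) :
    (x * (x ^ 3 + 2 * y ^ 3)) ^ 3 + (-(y * (2 * x ^ 3 + y ^ 3))) ^ 3 = 19 * (z * (x ^ 3 - y ^ 3)) ^ 3 := by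
  linear_combination (x ^ 3 - y ^ 3) ^ 3 * h

/-- Fermat at `3`: `3 ∣ x³ − x`. -/
theorem three_dvd_cube_sub (x : ℤ) : (3 : ℤ) ∣ x ^ 3 - x := by
  have h : ((x ^ 3 - x : ℤ) : ZMod 3) = 0 := by
    push_cast
    have : ∀ a : ZMod 3, a ^ 3 - a = 0 := by decide
    exact this _
  exact_mod_cast (ZMod.intCast_zmod_eq_zero_iff_dvd (x ^ 3 - x) 3).mp h

/-- The two cofactors `x³ + 2y³`, `2x³ + y³` of the duplication are coprime when `gcd(x,y) = 1` and `x ≢ y (mod 3)`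
(any common divisor divides `3x³` and `3y³`, and `x³ + 2y³ ≡ x − y (mod 3)`). -/
theorem cubic_cofactors_isCoprime {x y : ℤ} (hc : IsCoprime x y) (h3 : ¬ (3 : ℤ) ∣ x - y) :
    IsCoprime (x ^ 3 + 2 * y ^ 3) (2 * x ^ 3 + y ^ 3) := by
  set A := x ^ 3 + 2 * y ^ 3 with hA
  set B := 2 * x ^ 3 + y ^ 3 with hB
  -- `3 ∈ (A, B)`
  obtain ⟨u, v, huv⟩ := (hc.pow (m := 3) (n := 3))
  have h3AB : (2 * v - u) * A + (2 * u - v) * B = 3 := by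
    rw [hA, hB]; linear_combination 3 * huv
  -- `¬ 3 ∣ A` (since `A ≡ x − y (mod 3)`)
  have hA3 : ¬ (3 : ℤ) ∣ A := by
    intro hd
    apply h3
    have key : x - y = A - (x ^ 3 - x) - 2 * (y ^ 3 - y) - 3 * y := by rw [hA]; ring
    rw [key]
    exact dvd_sub (dvd_sub (dvd_sub hd (three_dvd_cube_sub x)) (dvd_mul_of_dvd_right (three_dvd_cube_sub y) 2))
      (dvd_mul_right 3 y)
  -- `IsCoprime A 3`, hence `IsCoprime A B`
  have hA3' : IsCoprime A 3 := by
    rw [Int.isCoprime_iff_gcd_eq_one]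
    have hd : Int.gcd A 3 ∣ 3 := Int.gcd_dvd_natAbs_right A 3
    rcases (Nat.dvd_prime Nat.prime_three).mp hd with h1 | h3'
    · exact h1
    · exfalso
      apply hA3
      have : ((Int.gcd A 3 : ℕ) : ℤ) ∣ A := Int.gcd_dvd_left _ _
      rw [h3'] at this
      exact_mod_cast this
  have hcomb : IsCoprime A ((2 * u - v) * B + A * (2 * v - u)) := by
    have : (2 * u - v) * B + A * (2 * v - u) = 3 := by linear_combination h3AB
    rw [this]; exact hA3'
  exact (hcomb.of_add_mul_left_right).of_mul_right_right

/-- **One duplication step preserves the invariants and doubles the `2`-part of `z`.** -/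
theorem cubic_step {x y z : ℤ} {j : ℕ} (h : x ^ 3 + y ^ 3 = 19 * z ^ 3) (hc : IsCoprime x y) (hx : Odd x) (hy : Odd y)
    (h3 : ¬ (3 : ℤ) ∣ x - y) (hz : z ≠ 0) (hdvd : (2 : ℤ) ^ (j + 1) ∣ z) :
    ∃ X Y Z : ℤ, X ^ 3 + Y ^ 3 = 19 * Z ^ 3 ∧ IsCoprime X Y ∧ Odd X ∧ Odd Y ∧ ¬ (3 : ℤ) ∣ X - Y ∧ Z ≠ 0 ∧
      (2 : ℤ) ^ (j + 2) ∣ Z := by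
  refine ⟨x * (x ^ 3 + 2 * y ^ 3), -(y * (2 * x ^ 3 + y ^ 3)), z * (x ^ 3 - y ^ 3), cubic_dup_identity h, ?_, ?_, ?_, ?_,
    ?_, ?_⟩
  · -- coprimality
    have hAB := cubic_cofactors_isCoprime hc h3
    have hxB : IsCoprime x (2 * x ^ 3 + y ^ 3) := by
      have := (hc.pow_right (n := 3)).add_mul_left_right (2 * x ^ 2)
      rwa [show y ^ 3 + x * (2 * x ^ 2) = 2 * x ^ 3 + y ^ 3 by ring] at this
    have hAy : IsCoprime (x ^ 3 + 2 * y ^ 3) y := by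
      have := (hc.pow_left (m := 3)).add_mul_left_left (2 * y ^ 2)
      rwa [show x ^ 3 + y * (2 * y ^ 2) = x ^ 3 + 2 * y ^ 3 by ring] at this
    exact ((hc.mul_right hxB).mul_left (hAy.mul_right hAB)).neg_right
  · -- `X` odd
    exact hx.mul (hx.pow.add_even (even_two.mul_right _))
  · -- `Y` odd
    exact (hy.mul ((even_two.mul_right _).add_odd hy.pow)).neg
  · -- `X − Y ≡ (x − y)⁴ (mod 3)`
    intro hd
    apply h3
    have key : x * (x ^ 3 + 2 * y ^ 3) - -(y * (2 * x ^ 3 + y ^ 3)) =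
        (x - y) ^ 4 + 3 * (2 * x * y * (x ^ 2 - x * y + y ^ 2)) := by ring
    rw [key] at hd
    have h4 : (3 : ℤ) ∣ (x - y) ^ 4 := (dvd_add_right (dvd_mul_right 3 _)).mp (by rwa [add_comm] at hd)
    exact Int.prime_three.dvd_of_dvd_pow h4
  · -- `Z ≠ 0`
    refine mul_ne_zero hz (sub_ne_zero.mpr fun hxy => h3 ?_)
    have : x = y := (Odd.strictMono_pow (by decide : Odd 3)).injective hxy
    rw [this, sub_self]
    exact dvd_zero 3
  · -- `2^{j+2} ∣ Z`
    have h2 : (2 : ℤ) ∣ x ^ 3 - y ^ 3 := even_iff_two_dvd.mp (hx.pow.sub_odd hy.pow)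
    rw [pow_succ]
    exact mul_dvd_mul hdvd h2

/-- **The orbit of `(3, 5, 2)` on `x³ + y³ = 19z³`**: after `j` duplications, `2^{j+1} ∣ z`. -/
theorem cubicFamily (j : ℕ) : ∃ x y z : ℤ, x ^ 3 + y ^ 3 = 19 * z ^ 3 ∧ IsCoprime x y ∧ Odd x ∧ Odd y ∧
    ¬ (3 : ℤ) ∣ x - y ∧ z ≠ 0 ∧ (2 : ℤ) ^ (j + 1) ∣ z := by
  induction j with
  | zero => exact ⟨3, 5, 2, by norm_num, ⟨2, -1, by norm_num⟩, by decide, by decide, by decide, by norm_num, by norm_num⟩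
  | succ j ih =>
    obtain ⟨x, y, z, h, hc, hx, hy, h3, hz, hdvd⟩ := ih
    exact cubic_step h hc hx hy h3 hz hdvd

/-- The same orbit, normalised to `x > 0` (negate all three coordinates if necessary). -/
theorem cubicFamily_pos (j : ℕ) : ∃ x y z : ℤ, x ^ 3 + y ^ 3 = 19 * z ^ 3 ∧ IsCoprime x y ∧ Odd x ∧ Odd y ∧
    z ≠ 0 ∧ (2 : ℤ) ^ (j + 1) ∣ z ∧ 0 < x := by
  obtain ⟨x, y, z, h, hc, hx, hy, -, hz, hdvd⟩ := cubicFamily j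
  have hx0 : x ≠ 0 := by rintro rfl; exact absurd hx (by decide)
  rcases lt_or_gt_of_ne hx0 with hneg | hpos
  · refine ⟨-x, -y, -z, by linear_combination -h, hc.neg_left.neg_right, hx.neg, hy.neg, neg_ne_zero.mpr hz,
      (dvd_neg).mpr hdvd, by linarith⟩
  · exact ⟨x, y, z, h, hc, hx, hy, hz, hdvd, hpos⟩

/-- Coprimality transfer: `x³ + y³ = 19z³`, `gcd(x, y) = 1` ⟹ `gcd(19z³, y) = 1` (`u x³ + v y = 1 ⟹ u·19z³ + (v − u y²)·y = 1`). -/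
theorem isCoprime_cube_part {x y z : ℤ} (h : x ^ 3 + y ^ 3 = 19 * z ^ 3) (hc : IsCoprime x y) :
    IsCoprime (19 * z ^ 3) y := by
  obtain ⟨u, v, huv⟩ := hc.pow_left (m := 3)
  exact ⟨u, v - u * y ^ 2, by linear_combination huv - u * h⟩

/-- From `IsCoprime` over `ℤ` to `Nat.Coprime` of absolute values. -/
theorem natAbs_coprime_of_isCoprime {m n : ℤ} (h : IsCoprime m n) : Nat.Coprime m.natAbs n.natAbs := by
  have := Int.isCoprime_iff_gcd_eq_one.mp h
  rwa [Int.gcd_eq_natAbs] at this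

/-! ## The radical of an orbit triple and the final count -/

/-- `rad(|x|³ · |y|³ · 19 (2^{j+1} t)³) ≤ |x| · |y| · 19 · 2t`. -/
theorem radical_cubic_triple_dvd (X Y t j : ℕ) :
    radical (X ^ 3 * Y ^ 3 * (19 * (2 ^ (j + 1) * t) ^ 3)) ∣ X * Y * (19 * (2 * t)) := by
  calc radical (X ^ 3 * Y ^ 3 * (19 * (2 ^ (j + 1) * t) ^ 3))
      ∣ radical (X ^ 3 * Y ^ 3) * radical (19 * (2 ^ (j + 1) * t) ^ 3) := radical_mul_dvd
    _ ∣ (radical (X ^ 3) * radical (Y ^ 3)) * (radical 19 * radical ((2 ^ (j + 1) * t) ^ 3)) :=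
        mul_dvd_mul radical_mul_dvd radical_mul_dvd
    _ ∣ (X * Y) * (19 * radical (2 ^ (j + 1) * t)) :=
        mul_dvd_mul (mul_dvd_mul (radical_pow_dvd.trans radical_dvd_self) (radical_pow_dvd.trans radical_dvd_self))
          (mul_dvd_mul radical_dvd_self radical_pow_dvd)
    _ ∣ (X * Y) * (19 * (radical (2 ^ (j + 1)) * radical t)) :=
        mul_dvd_mul_left _ (mul_dvd_mul_left _ radical_mul_dvd)
    _ ∣ (X * Y) * (19 * (2 * t)) :=
        mul_dvd_mul_left _ (mul_dvd_mul_left _ (mul_dvd_mul (radical_pow_dvd.trans radical_dvd_self) radical_dvd_self))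

/-- The count: an abc triple whose product is `|x|³|y|³·19·(2^{j+1}t)³` cannot satisfy `(abc)² ≤ C rad⁶` once `19⁴ C < 2^{6j}`. -/
theorem cubic_triple_violates {C : ℝ} {j X Y t a b c : ℕ} (hj : C * 19 ^ 4 < (2 : ℝ) ^ (6 * j)) (hX : 0 < X) (hY : 0 < Y)
    (ht : 0 < t) (hprod : a * b * c = X ^ 3 * Y ^ 3 * (19 * (2 ^ (j + 1) * t) ^ 3))
    (hineq : (((a * b * c : ℕ) : ℝ)) ^ (2 : ℕ) ≤ C * ((rad a b c : ℕ) : ℝ) ^ (6 : ℝ)) : False := by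
  -- the radical
  have hrad : rad a b c ≤ X * Y * (19 * (2 * t)) := by
    rw [rad_def, hprod]
    exact Nat.le_of_dvd (by positivity) (radical_cubic_triple_dvd X Y t j)
  have hradR : ((rad a b c : ℕ) : ℝ) ≤ 38 * ((X : ℝ) * Y * t) := by
    have : ((rad a b c : ℕ) : ℝ) ≤ ((X * Y * (19 * (2 * t)) : ℕ) : ℝ) := by exact_mod_cast hrad
    push_cast at this
    linarith
  have hrad6 : ((rad a b c : ℕ) : ℝ) ^ (6 : ℝ) ≤ (38 * ((X : ℝ) * Y * t)) ^ 6 := by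
    rw [show ((rad a b c : ℕ) : ℝ) ^ (6 : ℝ) = ((rad a b c : ℕ) : ℝ) ^ (6 : ℕ) by
      rw [← Real.rpow_natCast]; norm_num]
    exact pow_le_pow_left₀ (by positivity) hradR 6
  -- the product
  set W : ℝ := ((X : ℝ) * Y * t) ^ 6 with hW
  have hW0 : 0 < W := by positivity
  have hlhs : (((a * b * c : ℕ) : ℝ)) ^ (2 : ℕ) = 361 * (2 : ℝ) ^ (6 * (j + 1)) * W := by
    rw [hprod]; push_cast
    rw [hW]; ring
  -- compare
  have h1 : 361 * (2 : ℝ) ^ (6 * (j + 1)) * W ≤ C * 38 ^ 6 * W := by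
    calc 361 * (2 : ℝ) ^ (6 * (j + 1)) * W = (((a * b * c : ℕ) : ℝ)) ^ (2 : ℕ) := hlhs.symm
      _ ≤ C * ((rad a b c : ℕ) : ℝ) ^ (6 : ℝ) := hineq
      _ ≤ C * (38 * ((X : ℝ) * Y * t)) ^ 6 := by
          have hC : 0 ≤ C := by
            by_contra hneg
            push Not at hneg
            have : C * 19 ^ 4 < 0 := by nlinarith
            have h2 : (0 : ℝ) < 2 ^ (6 * j) := by positivity
            have h3 : (((a * b * c : ℕ) : ℝ)) ^ (2 : ℕ) ≤ C * ((rad a b c : ℕ) : ℝ) ^ (6 : ℝ) := hineq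
            have h4 : (0 : ℝ) ≤ (((a * b * c : ℕ) : ℝ)) ^ (2 : ℕ) := by positivity
            have h5 : C * ((rad a b c : ℕ) : ℝ) ^ (6 : ℝ) < 0 :=
              mul_neg_of_neg_of_pos hneg (Real.rpow_pos_of_pos (by
                have := one_le_rad a b c
                exact_mod_cast Nat.lt_of_lt_of_le Nat.zero_lt_one this) _)
            linarith
          exact mul_le_mul_of_nonneg_left hrad6 hC
      _ = C * 38 ^ 6 * W := by rw [hW]; ring
  have h2 : 361 * (2 : ℝ) ^ (6 * (j + 1)) ≤ C * 38 ^ 6 := le_of_mul_le_mul_right h1 hW0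
  have h3 : (2 : ℝ) ^ (6 * (j + 1)) = 2 ^ (6 * j) * 64 := by
    rw [mul_add, pow_add]; norm_num
  rw [h3] at h2
  nlinarith [h2, hj]

/-! ## `PolySzpiro 6` is false -/

/-- **Szpiro's `ε` is necessary (abc-coordinates): `PolySzpiro 6` is FALSE** — there is no `C` with `(abc)² ≤ C · rad(abc)⁶` for all abc
triples.  (Matrix of `Ideator4.PolySzpiro` verbatim at `s = 6`.)  Witnesses: the `2`-adically convergent duplication orbit of `(3,5,2)` on
`x³ + y³ = 19z³` (`cubicFamily_pos`), read as abc triples `{x³, |y|³, 19|z|³}` according to signs. -/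
theorem not_polySzpiro_six :
    ¬ ∃ C : ℝ, 0 < C ∧ ∀ a b c : ℕ, IsABCTriple a b c →
      (((a * b * c : ℕ) : ℝ)) ^ (2 : ℕ) ≤ C * ((rad a b c : ℕ) : ℝ) ^ (6 : ℝ) := by
  rintro ⟨C, hC, hPS⟩
  -- `j` with `19⁴ C < 2^{6j}`
  obtain ⟨j, hj0⟩ := exists_nat_gt (C * 19 ^ 4)
  have hj : C * 19 ^ 4 < (2 : ℝ) ^ (6 * j) := by
    have h1 : (j : ℝ) < (2 : ℝ) ^ j := by exact_mod_cast Nat.lt_two_pow_self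
    have h2 : (2 : ℝ) ^ j ≤ 2 ^ (6 * j) := pow_le_pow_right₀ (by norm_num) (by omega)
    linarith
  -- the orbit point
  obtain ⟨x, y, z, h, hc, hx, hy, hz, hdvd, hxpos⟩ := cubicFamily_pos j
  have hy0 : y ≠ 0 := by rintro rfl; exact absurd hy (by decide)
  -- natural coordinates
  set X : ℕ := x.natAbs with hX
  set Yn : ℕ := y.natAbs with hYn
  set Zn : ℕ := z.natAbs with hZn
  have hXpos : 0 < X := Int.natAbs_pos.mpr hxpos.ne'
  have hYpos : 0 < Yn := Int.natAbs_pos.mpr hy0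
  have hZpos : 0 < Zn := Int.natAbs_pos.mpr hz
  have hXx : ((X : ℕ) : ℤ) = x := Int.natAbs_of_nonneg hxpos.le
  -- `Zn = 2^{j+1} t`
  have hdvdN : 2 ^ (j + 1) ∣ Zn := by
    have := Int.natAbs_dvd_natAbs.mpr hdvd
    rwa [Int.natAbs_pow] at this
  obtain ⟨t, ht⟩ := hdvdN
  have htpos : 0 < t := by
    rcases Nat.eq_zero_or_pos t with h0 | h0
    · rw [h0, mul_zero] at ht; omega
    · exact h0
  -- coprimality data
  have hcopXY : Nat.Coprime X Yn := natAbs_coprime_of_isCoprime hc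
  have hcop19y : Nat.Coprime (19 * Zn ^ 3) Yn := by
    have := natAbs_coprime_of_isCoprime (isCoprime_cube_part h hc)
    rwa [Int.natAbs_mul, Int.natAbs_pow] at this
  have hcop19x : Nat.Coprime (19 * Zn ^ 3) X := by
    have h' : y ^ 3 + x ^ 3 = 19 * z ^ 3 := by linear_combination h
    have := natAbs_coprime_of_isCoprime (isCoprime_cube_part h' hc.symm)
    rwa [Int.natAbs_mul, Int.natAbs_pow] at this
  -- sign cases
  rcases lt_or_gt_of_ne hy0 with hyneg | hypos
  · -- `y < 0`: `x³ − Yn³ = 19 z³`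
    have hYy : ((Yn : ℕ) : ℤ) = -y := Int.ofNat_natAbs_of_nonpos hyneg.le
    rcases lt_or_gt_of_ne hz with hzneg | hzpos
    · -- `z < 0`: `x³ + 19 Zn³ = Yn³`
      have hZz : ((Zn : ℕ) : ℤ) = -z := Int.ofNat_natAbs_of_nonpos hzneg.le
      have habc : IsABCTriple (X ^ 3) (19 * Zn ^ 3) (Yn ^ 3) := by
        refine ⟨by positivity, by positivity, ?_, (hcop19x.symm).pow_left 3⟩
        have : (((X ^ 3 + 19 * Zn ^ 3 : ℕ)) : ℤ) = ((Yn ^ 3 : ℕ) : ℤ) := by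
          push_cast; rw [hXx, hYy, hZz]; linear_combination h
        exact_mod_cast this
      refine cubic_triple_violates hj hXpos hYpos htpos (a := X ^ 3) (b := 19 * Zn ^ 3) (c := Yn ^ 3) ?_ (hPS _ _ _ habc)
      rw [ht]; ring
    · -- `z > 0`: `Yn³ + 19 Zn³ = x³`
      have hZz : ((Zn : ℕ) : ℤ) = z := Int.natAbs_of_nonneg hzpos.le
      have habc : IsABCTriple (Yn ^ 3) (19 * Zn ^ 3) (X ^ 3) := by
        refine ⟨by positivity, by positivity, ?_, (hcop19y.symm).pow_left 3⟩
        have : (((Yn ^ 3 + 19 * Zn ^ 3 : ℕ)) : ℤ) = ((X ^ 3 : ℕ) : ℤ) := by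
          push_cast; rw [hXx, hYy, hZz]; linear_combination -h
        exact_mod_cast this
      refine cubic_triple_violates hj hXpos hYpos htpos (a := Yn ^ 3) (b := 19 * Zn ^ 3) (c := X ^ 3) ?_ (hPS _ _ _ habc)
      rw [ht]; ring
  · -- `y > 0`: then `z > 0` and `x³ + Yn³ = 19 Zn³`
    have hYy : ((Yn : ℕ) : ℤ) = y := Int.natAbs_of_nonneg hypos.le
    have hzpos : 0 < z := by
      by_contra hle
      push Not at hle
      have h1 : z ^ 3 ≤ 0 := Odd.pow_nonpos (by decide) hle
      have h2 : 0 < x ^ 3 := pow_pos hxpos 3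
      have h3 : 0 < y ^ 3 := pow_pos hypos 3
      linarith
    have hZz : ((Zn : ℕ) : ℤ) = z := Int.natAbs_of_nonneg hzpos.le
    have habc : IsABCTriple (X ^ 3) (Yn ^ 3) (19 * Zn ^ 3) := by
      refine ⟨by positivity, by positivity, ?_, hcopXY.pow 3 3⟩
      have : (((X ^ 3 + Yn ^ 3 : ℕ)) : ℤ) = ((19 * Zn ^ 3 : ℕ) : ℤ) := by
        push_cast; rw [hXx, hYy, hZz]; exact h
      exact_mod_cast this
    refine cubic_triple_violates hj hXpos hYpos htpos (a := X ^ 3) (b := Yn ^ 3) (c := 19 * Zn ^ 3) ?_ (hPS _ _ _ habc)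
    rw [ht]

/-- Hence `PolySzpiro s` is false for every `s ≤ 6` (monotonicity of the dial, `Negative.PolySzpiroFloor.polySzpiro_mono`). -/
theorem not_polySzpiro_of_le_six {s : ℝ} (hs : s ≤ 6) :
    ¬ ∃ C : ℝ, 0 < C ∧ ∀ a b c : ℕ, IsABCTriple a b c →
      (((a * b * c : ℕ) : ℝ)) ^ (2 : ℕ) ≤ C * ((rad a b c : ℕ) : ℝ) ^ s :=
  fun h => not_polySzpiro_six (polySzpiro_mono hs h)

/-- **The S⁺4 dial, exactly**: under `ABC`, `PolySzpiro s ⟺ 6 < s` for every real `s` (the forward direction is unconditional). -/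
theorem polySzpiro_iff_of_abc (habc : ABC) (s : ℝ) :
    (∃ C : ℝ, 0 < C ∧ ∀ a b c : ℕ, IsABCTriple a b c →
      (((a * b * c : ℕ) : ℝ)) ^ (2 : ℕ) ≤ C * ((rad a b c : ℕ) : ℝ) ^ s) ↔ 6 < s :=
  ⟨fun h => lt_of_not_ge fun hs => not_polySzpiro_of_le_six hs h, fun hs => polySzpiro_of_abc habc hs⟩

/-- The first three orbit points, for the record: `(3,5,2)`, then `(3·277, −5·179, 2·(−98)) = (831, −895, −196)` (`v₂(z) = 2`),
and the duplication of that has `v₂(z) ≥ 3`; e.g. `831³ + 19·196³ = 895³`, an abc triple with `(abc)² / rad⁶ = 2⁶/19⁴·(…)`. -/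
example : (3 : ℤ) ^ 3 + 5 ^ 3 = 19 * 2 ^ 3 ∧ (3 * (3 ^ 3 + 2 * 5 ^ 3) : ℤ) = 831 ∧ (-(5 * (2 * 3 ^ 3 + 5 ^ 3)) : ℤ) = -895 ∧
    (2 * (3 ^ 3 - 5 ^ 3) : ℤ) = -196 ∧ (831 : ℤ) ^ 3 + 19 * 196 ^ 3 = 895 ^ 3 := by norm_num

end Summit.ABC.ABC.Theorems.TowerFourSubLiouville.Negative
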